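import Literature.NumberTheory.LFunctions.KloostermanFractionsOffDiagPhase
import HarnessLib

/-!
# Trilinear forms with Kloosterman fractions: the phase of an off-diagonal pair (Bettin–Chandee §4.1.2–4.1.3, general `A`)

Topic `NumberTheory/LFunctions`.  S. Bettin, V. Chandee, *Trilinear forms with Kloosterman
fractions*, Adv. Math. 328 (2018), §4.1.2: after the Cauchy–Schwarz inequality "with respect to
the sums over `𝔭₁,𝔭₂,𝔮₁,𝔮₂,n₁',n₂',c,a₂`" the argument of the exponential of a pair
`(ℓ₁,ℓ₂,d,a₁), (ℓ₁',ℓ₂',d',a₁')` is ((vha))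
"`ϑ(c(a₁−a₁')(𝔭₁n₁')‾/(b𝔭₂) − (da₁ℓ̃₂' − d'a₁'ℓ̃₂)(ℓ̃₂ℓ̃₂'b𝔭₂𝔮₂n₂')‾/(𝔭₁n₁') − a₂(dℓ̃₁' − d'ℓ̃₁)(ℓ̃₁ℓ̃₁'𝔭₁n₁'b𝔮₁)‾/(𝔮₂n₂'))`".
This file PROVES the corresponding combination of the four Kloosterman-fraction phases produced by
`BC_off_msum_tuple_eq` (`TrilinearKloostermanFractionsOffTuple.lean`; two numerators, `𝔭ᵢ = 𝔮ᵢ = 1`,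
and — unlike the tree's `kfw_pair_phase` — two possibly DIFFERENT primes `ℓ₂, ℓ₂'`):

* `BC_first_modulus_zmod` — in `ℤ/n₁`:
  `(−k₁d)(bℓ₂n₂)⁻¹ + (k₁'d')(bℓ₂'n₂)⁻¹ = −(k₁dℓ₂' − k₁'d'ℓ₂)(bℓ₂ℓ₂'n₂)⁻¹`;
* **`BC_pair_phase2`** — with `Y₁ = k₁dℓ₂' − k₁'d'ℓ₂` and `Y₂ = dℓ₁' − d'ℓ₁`:
  `[e(−k₁d(bℓ₂n₂)‾/n₁) conj e(−k₂d(−bℓ₁n₁)‾/n₂)] · conj[e(−k₁'d'(bℓ₂'n₂)‾/n₁) conj e(−k₂d'(−bℓ₁'n₁)‾/n₂)]`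
  `= e(−Y₁(bℓ₂ℓ₂'n₂)‾/n₁) · e(−k₂Y₂(bℓ₁ℓ₁'n₁)‾/n₂)`
  (for the trilinear form `k₁ = ϑa₁`, `k₁' = ϑa₁'`, `k₂ = ϑa₂`; the source's `Δ` is
  `a₂Y₂ℓ₂ℓ₂' − (a₁dℓ₂' − a₁'d'ℓ₂)ℓ₁ℓ₁'`).

No new named facts (D-0026).

## References

* S. Bettin, V. Chandee, Adv. Math. 328 (2018) 1234–1262 (arXiv:1502.00769), §4.1.2 (vha),
  §4.1.3 (fvw). [BettinChandee2018]
* W. Duke, J. Friedlander, H. Iwaniec, Invent. Math. 128 (1997) 23–43. [DukeFriedlanderIwaniec1997]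
-/

noncomputable section

open Finset

namespace Literature.NumberTheory.LFunctions

/-- In `ℤ/n₁`, with `b, ℓ₂, ℓ₂', n₂` units:
`(−k₁d)(bℓ₂n₂)⁻¹ + (k₁'d')(bℓ₂'n₂)⁻¹ = −(k₁dℓ₂' − k₁'d'ℓ₂)(bℓ₂ℓ₂'n₂)⁻¹`. [folklore] -/
theorem BC_first_modulus_zmod {n₁ : ℕ} (k₁ k₁' d d' : ℤ) {b ℓ₂ ℓ₂' n₂ : ℕ}
    (hu : IsUnit ((b * (ℓ₂ * ℓ₂' * n₂) : ℕ) : ZMod n₁)) :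
    ((-(k₁ * d) : ℤ) : ZMod n₁) * ((b * (ℓ₂ * n₂ : ℤ) : ℤ) : ZMod n₁)⁻¹ +
        ((k₁' * d' : ℤ) : ZMod n₁) * ((b * (ℓ₂' * n₂ : ℤ) : ℤ) : ZMod n₁)⁻¹ =
      ((-(k₁ * d * ℓ₂' - k₁' * d' * ℓ₂) : ℤ) : ZMod n₁) *
        ((b * (ℓ₂ * ℓ₂' * n₂) : ℕ) : ZMod n₁)⁻¹ := by
  set U : ZMod n₁ := ((b * (ℓ₂ * ℓ₂' * n₂) : ℕ) : ZMod n₁) with hUdef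
  have hUinv : U * U⁻¹ = 1 := ZMod.mul_inv_of_unit _ hu
  have h1 : ((b * (ℓ₂ * n₂ : ℤ) : ℤ) : ZMod n₁)⁻¹ * U = (ℓ₂' : ZMod n₁) := by
    have hv : IsUnit (((b * (ℓ₂ * n₂ : ℤ) : ℤ) : ZMod n₁)) := by
      have : ((b * (ℓ₂ * n₂ : ℤ) : ℤ) : ZMod n₁) * (ℓ₂' : ZMod n₁) = U := by
        rw [hUdef]; push_cast; ring
      exact isUnit_of_mul_isUnit_left (this ▸ hu)
    have hvinv := ZMod.inv_mul_of_unit _ hv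
    calc ((b * (ℓ₂ * n₂ : ℤ) : ℤ) : ZMod n₁)⁻¹ * U
        = ((b * (ℓ₂ * n₂ : ℤ) : ℤ) : ZMod n₁)⁻¹ *
            (((b * (ℓ₂ * n₂ : ℤ) : ℤ) : ZMod n₁) * (ℓ₂' : ZMod n₁)) := by
          rw [hUdef]; push_cast; ring
      _ = (ℓ₂' : ZMod n₁) := by rw [← mul_assoc, hvinv, one_mul]
  have h2 : ((b * (ℓ₂' * n₂ : ℤ) : ℤ) : ZMod n₁)⁻¹ * U = (ℓ₂ : ZMod n₁) := by
    have hv : IsUnit (((b * (ℓ₂' * n₂ : ℤ) : ℤ) : ZMod n₁)) := by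
      have : ((b * (ℓ₂' * n₂ : ℤ) : ℤ) : ZMod n₁) * (ℓ₂ : ZMod n₁) = U := by
        rw [hUdef]; push_cast; ring
      exact isUnit_of_mul_isUnit_left (this ▸ hu)
    have hvinv := ZMod.inv_mul_of_unit _ hv
    calc ((b * (ℓ₂' * n₂ : ℤ) : ℤ) : ZMod n₁)⁻¹ * U
        = ((b * (ℓ₂' * n₂ : ℤ) : ℤ) : ZMod n₁)⁻¹ *
            (((b * (ℓ₂' * n₂ : ℤ) : ℤ) : ZMod n₁) * (ℓ₂ : ZMod n₁)) := by
          rw [hUdef]; push_cast; ring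
      _ = (ℓ₂ : ZMod n₁) := by rw [← mul_assoc, hvinv, one_mul]
  set C : ZMod n₁ := ((-(k₁ * d * ℓ₂' - k₁' * d' * ℓ₂) : ℤ) : ZMod n₁) with hC
  have eX : ((-(k₁ * d) : ℤ) : ZMod n₁) * ((b * (ℓ₂ * n₂ : ℤ) : ℤ) : ZMod n₁)⁻¹ * U =
      ((-(k₁ * d) : ℤ) : ZMod n₁) * (ℓ₂' : ZMod n₁) := by rw [mul_assoc, h1]
  have eX' : ((k₁' * d' : ℤ) : ZMod n₁) * ((b * (ℓ₂' * n₂ : ℤ) : ℤ) : ZMod n₁)⁻¹ * U =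
      ((k₁' * d' : ℤ) : ZMod n₁) * (ℓ₂ : ZMod n₁) := by rw [mul_assoc, h2]
  have key : (((-(k₁ * d) : ℤ) : ZMod n₁) * ((b * (ℓ₂ * n₂ : ℤ) : ℤ) : ZMod n₁)⁻¹ +
        ((k₁' * d' : ℤ) : ZMod n₁) * ((b * (ℓ₂' * n₂ : ℤ) : ℤ) : ZMod n₁)⁻¹) * U = C := by
    rw [add_mul, eX, eX', hC]
    push_cast
    ring
  calc ((-(k₁ * d) : ℤ) : ZMod n₁) * ((b * (ℓ₂ * n₂ : ℤ) : ℤ) : ZMod n₁)⁻¹ +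
        ((k₁' * d' : ℤ) : ZMod n₁) * ((b * (ℓ₂' * n₂ : ℤ) : ℤ) : ZMod n₁)⁻¹
      = (((-(k₁ * d) : ℤ) : ZMod n₁) * ((b * (ℓ₂ * n₂ : ℤ) : ℤ) : ZMod n₁)⁻¹ +
          ((k₁' * d' : ℤ) : ZMod n₁) * ((b * (ℓ₂' * n₂ : ℤ) : ℤ) : ZMod n₁)⁻¹) * (U * U⁻¹) := by
        rw [hUinv, mul_one]
    _ = ((((-(k₁ * d) : ℤ) : ZMod n₁) * ((b * (ℓ₂ * n₂ : ℤ) : ℤ) : ZMod n₁)⁻¹ +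
          ((k₁' * d' : ℤ) : ZMod n₁) * ((b * (ℓ₂' * n₂ : ℤ) : ℤ) : ZMod n₁)⁻¹) * U) * U⁻¹ := by
        ring
    _ = C * U⁻¹ := by rw [key]

/-- **The phase of a pair `(ℓ₁,ℓ₂,d,a₁), (ℓ₁',ℓ₂',d',a₁')`** (same `n₁, n₂, a₂`), two numerators:
with `b(ℓ₂ℓ₂'n₂)` invertible modulo `n₁` and `b(ℓ₁ℓ₁'n₁)` invertible modulo `n₂`,
`[e(−k₁d(bℓ₂n₂)‾/n₁) conj e(−k₂d(−bℓ₁n₁)‾/n₂)] conj[e(−k₁'d'(bℓ₂'n₂)‾/n₁) conj e(−k₂d'(−bℓ₁'n₁)‾/n₂)]`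
`= e(−(k₁dℓ₂'−k₁'d'ℓ₂)(bℓ₂ℓ₂'n₂)‾/n₁) e(−k₂(dℓ₁'−d'ℓ₁)(bℓ₁ℓ₁'n₁)‾/n₂)`.
[cite: BettinChandee2018, §4.1.2 (vha)] -/
theorem BC_pair_phase2 (k₁ k₁' k₂ d d' : ℤ) (b ℓ₁ ℓ₁' ℓ₂ ℓ₂' : ℕ) {n₁ n₂ : ℕ} (hn₁ : 0 < n₁)
    (hn₂ : 0 < n₂) (hu₁ : IsUnit ((b * (ℓ₂ * ℓ₂' * n₂) : ℕ) : ZMod n₁))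
    (hu₂ : IsUnit ((b * (ℓ₁ * ℓ₁' * n₁) : ℕ) : ZMod n₂)) :
    (Complex.exp (2 * Real.pi * Complex.I *
        (((-(k₁ * d) : ℤ) : ℂ) * (((((b * (ℓ₂ * n₂ : ℤ) : ℤ) : ZMod n₁)⁻¹).val : ℕ) : ℂ) /
          (n₁ : ℂ))) *
      (starRingEnd ℂ) (Complex.exp (2 * Real.pi * Complex.I *
        (((-(k₂ * d) : ℤ) : ℂ) * (((((b * (-(ℓ₁ * n₁ : ℤ)) : ℤ) : ZMod n₂)⁻¹).val : ℕ) : ℂ) /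
          (n₂ : ℂ))))) *
    (starRingEnd ℂ) (Complex.exp (2 * Real.pi * Complex.I *
        (((-(k₁' * d') : ℤ) : ℂ) * (((((b * (ℓ₂' * n₂ : ℤ) : ℤ) : ZMod n₁)⁻¹).val : ℕ) : ℂ) /
          (n₁ : ℂ))) *
      (starRingEnd ℂ) (Complex.exp (2 * Real.pi * Complex.I *
        (((-(k₂ * d') : ℤ) : ℂ) * (((((b * (-(ℓ₁' * n₁ : ℤ)) : ℤ) : ZMod n₂)⁻¹).val : ℕ) : ℂ) /
          (n₂ : ℂ))))) =
    Complex.exp (2 * Real.pi * Complex.I *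
        (((-(k₁ * d * ℓ₂' - k₁' * d' * ℓ₂) : ℤ) : ℂ) *
          (((((b * (ℓ₂ * ℓ₂' * n₂) : ℕ) : ZMod n₁)⁻¹).val : ℕ) : ℂ) / (n₁ : ℂ))) *
      Complex.exp (2 * Real.pi * Complex.I *
        (((-(k₂ * (d * ℓ₁' - d' * ℓ₁)) : ℤ) : ℂ) *
          (((((b * (ℓ₁ * ℓ₁' * n₁) : ℕ) : ZMod n₂)⁻¹).val : ℕ) : ℂ) / (n₂ : ℂ))) := by
  haveI : NeZero n₁ := ⟨hn₁.ne'⟩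
  haveI : NeZero n₂ := ⟨hn₂.ne'⟩
  -- notation
  set u : ℕ := (((b * (ℓ₂ * n₂ : ℤ) : ℤ) : ZMod n₁)⁻¹).val with hu
  set u' : ℕ := (((b * (ℓ₂' * n₂ : ℤ) : ℤ) : ZMod n₁)⁻¹).val with hu'
  set w₁ : ℕ := (((b * (ℓ₂ * ℓ₂' * n₂) : ℕ) : ZMod n₁)⁻¹).val with hw₁
  set v : ℕ := (((b * (-(ℓ₁ * n₁ : ℤ)) : ℤ) : ZMod n₂)⁻¹).val with hv
  set v' : ℕ := (((b * (-(ℓ₁' * n₁ : ℤ)) : ℤ) : ZMod n₂)⁻¹).val with hv'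
  set w₂ : ℕ := (((b * (ℓ₁ * ℓ₁' * n₁) : ℕ) : ZMod n₂)⁻¹).val with hw₂
  -- conjugates
  rw [map_mul, Complex.conj_conj, kfw_conj_e, kfw_conj_e]
  -- regroup: (modulus n₁ factors) * (modulus n₂ factors)
  have hregroup : ∀ (A B C D' : ℂ), A * B * (C * D') = (A * C) * (B * D') := fun _ _ _ _ => by ring
  rw [hregroup]
  congr 1
  · -- modulus `n₁`: `e((−k₁d) u/n₁) e((k₁'d') u'/n₁) = e(−Y₁ w₁/n₁)`
    rw [show (-(-(k₁' * d')) : ℤ) = k₁' * d' by ring, ← Complex.exp_add]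
    have hsum : 2 * (Real.pi : ℂ) * Complex.I * (((-(k₁ * d) : ℤ) : ℂ) * (u : ℂ) / (n₁ : ℂ)) +
        2 * Real.pi * Complex.I * (((k₁' * d' : ℤ) : ℂ) * (u' : ℂ) / (n₁ : ℂ)) =
        2 * Real.pi * Complex.I * (((1 : ℤ) : ℂ) *
          (((-(k₁ * d) * u + (k₁' * d') * u' : ℤ)) : ℂ) / (n₁ : ℂ)) := by
      push_cast; ring
    rw [hsum]
    have hcong : (-(k₁ * d) * u + (k₁' * d') * u' : ℤ) ≡
        (-(k₁ * d * ℓ₂' - k₁' * d' * ℓ₂)) * (w₁ : ℤ) [ZMOD n₁] := by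
      rw [← ZMod.intCast_eq_intCast_iff]
      push_cast
      rw [hu, hu', hw₁, ZMod.natCast_zmod_val, ZMod.natCast_zmod_val, ZMod.natCast_zmod_val]
      have h := BC_first_modulus_zmod k₁ k₁' d d' hu₁
      push_cast at h ⊢
      linear_combination h
    rw [kfs_e_congr_int 1 hn₁ hcong]
    congr 1
    push_cast
    ring
  · -- modulus `n₂`: `e((k₂d) v/n₂) e((−k₂d') v'/n₂) = e(−k₂Y₂ w₂/n₂)`
    rw [show (-(-(k₂ * d)) : ℤ) = k₂ * d by ring, ← Complex.exp_add]
    have hsum : 2 * (Real.pi : ℂ) * Complex.I * (((k₂ * d : ℤ) : ℂ) * (v : ℂ) / (n₂ : ℂ)) +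
        2 * Real.pi * Complex.I * (((-(k₂ * d') : ℤ) : ℂ) * (v' : ℂ) / (n₂ : ℂ)) =
        2 * Real.pi * Complex.I * (((1 : ℤ) : ℂ) * (((k₂ * d * v + -(k₂ * d') * v' : ℤ)) : ℂ) /
          (n₂ : ℂ)) := by
      push_cast; ring
    rw [hsum]
    have hcong : (k₂ * d * v + -(k₂ * d') * v' : ℤ) ≡
        (-(k₂ * (d * ℓ₁' - d' * ℓ₁))) * (w₂ : ℤ) [ZMOD n₂] := by
      rw [← ZMod.intCast_eq_intCast_iff]
      push_cast
      rw [hv, hv', hw₂, ZMod.natCast_zmod_val, ZMod.natCast_zmod_val, ZMod.natCast_zmod_val]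
      have h := kfw_second_modulus_zmod k₂ d d' hu₂
      push_cast at h ⊢
      linear_combination h
    rw [kfs_e_congr_int 1 hn₂ hcong]
    congr 1
    push_cast
    ring

/-- **The phase of a pair after reciprocity** (two numerators, primes `ℓ₂, ℓ₂'` with
`(bℓ₂ℓ₂', n₁) = 1`; the tree's `kfw_pair_final` is the case `k₁ = k₁' = k₂`, `ℓ₂ = ℓ₂'`): with
`S = ℓ₁ℓ₁'n₁`, `Y₁ = k₁dℓ₂' − k₁'d'ℓ₂`, `Y₂ = dℓ₁' − d'ℓ₁`, `σ₁ = (bℓ₂ℓ₂')‾^{(n₁)}`, `σ = b̄^{(S)}`,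
`a = (−Y₁)σ₁ℓ₁ℓ₁' + (k₂Y₂)σ`,
`E conj E' = e(k₂Y₂ (n₂S)‾^{(b)}/b) · e(−k₂Y₂/(bSn₂)) · e(a n̄₂^{(S)}/S)` — a factor depending on
`n₂` only modulo `b`, a small smooth twist, and a Kloosterman fraction modulo `S`
(Bettin–Chandee §4.1.3 (fvw): "`ϑΔ(ℓ̃₂ℓ̃₂'b𝔭₂𝔮₂n₂')‾/(ℓ̃₁ℓ̃₁'𝔮₁𝔭₁n₁') − a₂(dℓ̃₁'−d'ℓ̃₁)/(bℓ̃₁ℓ̃₁'𝔭₁n₁'𝔮₁𝔮₂n₂') + …`").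
[cite: BettinChandee2018, §4.1.3 (fvw)] -/
theorem BC_pair_final2 (k₁ k₁' k₂ d d' : ℤ) {b ℓ₁ ℓ₁' ℓ₂ ℓ₂' n₁ n₂ : ℕ} (hb : 0 < b)
    (hℓ₁ : 0 < ℓ₁) (hℓ₁' : 0 < ℓ₁') (hn₁ : 0 < n₁) (hn₂ : 0 < n₂) (hS1 : 1 < ℓ₁ * ℓ₁' * n₁)
    (hc₁ : (b * (ℓ₂ * ℓ₂')).Coprime n₁) (hn₂₁ : n₂.Coprime n₁) (hbS : b.Coprime (ℓ₁ * ℓ₁' * n₁))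
    (hBn : (b * (ℓ₁ * ℓ₁' * n₁)).Coprime n₂) :
    (Complex.exp (2 * Real.pi * Complex.I *
        (((-(k₁ * d) : ℤ) : ℂ) * (((((b * (ℓ₂ * n₂ : ℤ) : ℤ) : ZMod n₁)⁻¹).val : ℕ) : ℂ) /
          (n₁ : ℂ))) *
      (starRingEnd ℂ) (Complex.exp (2 * Real.pi * Complex.I *
        (((-(k₂ * d) : ℤ) : ℂ) * (((((b * (-(ℓ₁ * n₁ : ℤ)) : ℤ) : ZMod n₂)⁻¹).val : ℕ) : ℂ) /
          (n₂ : ℂ))))) *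
    (starRingEnd ℂ) (Complex.exp (2 * Real.pi * Complex.I *
        (((-(k₁' * d') : ℤ) : ℂ) * (((((b * (ℓ₂' * n₂ : ℤ) : ℤ) : ZMod n₁)⁻¹).val : ℕ) : ℂ) /
          (n₁ : ℂ))) *
      (starRingEnd ℂ) (Complex.exp (2 * Real.pi * Complex.I *
        (((-(k₂ * d') : ℤ) : ℂ) * (((((b * (-(ℓ₁' * n₁ : ℤ)) : ℤ) : ZMod n₂)⁻¹).val : ℕ) : ℂ) /
          (n₂ : ℂ))))) =
    Complex.exp (2 * Real.pi * Complex.I *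
        (((k₂ * (d * ℓ₁' - d' * ℓ₁) : ℤ) : ℂ) *
          (((((((n₂ : ℤ) * (ℓ₁ * ℓ₁' * n₁ : ℕ) : ℤ)) : ZMod b)⁻¹).val : ℕ) : ℂ) / (b : ℂ))) *
      Complex.exp (2 * Real.pi * Complex.I *
        (((-(k₂ * (d * ℓ₁' - d' * ℓ₁)) : ℤ) : ℂ) / ((b * (ℓ₁ * ℓ₁' * n₁) * n₂ : ℕ) : ℂ))) *
      Complex.exp (2 * Real.pi * Complex.I *
        ((((-(k₁ * d * ℓ₂' - k₁' * d' * ℓ₂)) *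
              ((((b * (ℓ₂ * ℓ₂') : ℕ) : ZMod n₁)⁻¹).val : ℕ) * (ℓ₁ * ℓ₁' : ℕ) +
            (k₂ * (d * ℓ₁' - d' * ℓ₁)) * (((b : ZMod (ℓ₁ * ℓ₁' * n₁))⁻¹).val : ℕ) : ℤ) : ℂ) *
          (((((n₂ : ℤ) : ZMod (ℓ₁ * ℓ₁' * n₁))⁻¹).val : ℕ) : ℂ) / ((ℓ₁ * ℓ₁' * n₁ : ℕ) : ℂ))) := by
  set S : ℕ := ℓ₁ * ℓ₁' * n₁ with hSdef
  set Y₁ : ℤ := k₁ * d * ℓ₂' - k₁' * d' * ℓ₂ with hY₁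
  set Y : ℤ := d * ℓ₁' - d' * ℓ₁ with hY
  have hS0 : 0 < S := lt_trans zero_lt_one hS1
  haveI : NeZero S := ⟨hS0.ne'⟩
  haveI : NeZero n₂ := ⟨hn₂.ne'⟩
  haveI : NeZero n₁ := ⟨hn₁.ne'⟩
  have ht : 0 < ℓ₁ * ℓ₁' := Nat.mul_pos hℓ₁ hℓ₁'
  -- Step 1: the pair phase
  have hu₂ : IsUnit ((b * (ℓ₁ * ℓ₁' * n₁) : ℕ) : ZMod n₂) := (ZMod.isUnit_iff_coprime _ _).mpr hBn
  have hu₁ : IsUnit ((b * (ℓ₂ * ℓ₂' * n₂) : ℕ) : ZMod n₁) := by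
    rw [ZMod.isUnit_iff_coprime, show b * (ℓ₂ * ℓ₂' * n₂) = (b * (ℓ₂ * ℓ₂')) * n₂ by ring]
    exact Nat.Coprime.mul_left hc₁ hn₂₁
  rw [BC_pair_phase2 k₁ k₁' k₂ d d' b ℓ₁ ℓ₁' ℓ₂ ℓ₂' hn₁ hn₂ hu₁ hu₂]
  -- Step 2: the modulus-`n₁` factor lifted to modulus `S`
  have hn₂S : IsUnit ((n₂ : ℤ) : ZMod S) := by
    rw [Int.cast_natCast, ZMod.isUnit_iff_coprime]
    exact (Nat.Coprime.coprime_mul_left hBn).symm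
  have hcast₁ : ((b * (ℓ₂ * ℓ₂' * n₂) : ℕ) : ZMod n₁) =
      (((n₂ : ℤ) * (b * (ℓ₂ * ℓ₂') : ℕ) : ℤ) : ZMod n₁) := by
    push_cast; ring
  have hlift := kfw_lift (-Y₁) hSdef hn₁ ht hc₁ hn₂S
  rw [hcast₁, hlift]
  -- Step 3: reciprocity for the modulus-`n₂` factor, then split off `b`
  have hB1 : 1 < b * S := lt_of_lt_of_le hS1 (Nat.le_mul_of_pos_left _ hb)
  have hrec := kfw_recip hB1 hn₂ hBn (-(k₂ * Y))
  rw [hrec]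
  have hn₂bS : IsUnit ((n₂ : ℤ) : ZMod (b * S)) := by
    rw [Int.cast_natCast, ZMod.isUnit_iff_coprime]; exact hBn.symm
  have hsplit := kfw_b_split hb hS0 hbS (k₂ * Y) hn₂bS
  rw [show (-(-(k₂ * Y)) : ℤ) = k₂ * Y by ring, ← Int.cast_natCast (R := ZMod (b * S)) n₂, hsplit]
  -- Step 4: combine the two Kloosterman fractions modulo `S`
  have hcomb := kfw_e_mul_e
    (-Y₁ * ((((b * (ℓ₂ * ℓ₂') : ℕ) : ZMod n₁)⁻¹).val : ℕ) * (ℓ₁ * ℓ₁' : ℕ))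
    (k₂ * Y * (((b : ZMod S)⁻¹).val : ℕ)) ((((n₂ : ℤ) : ZMod S)⁻¹).val) S
  calc Complex.exp (2 * Real.pi * Complex.I *
          (((-Y₁ * ((((b * (ℓ₂ * ℓ₂') : ℕ) : ZMod n₁)⁻¹).val : ℕ) * (ℓ₁ * ℓ₁' : ℕ) : ℤ) : ℂ) *
            (((((n₂ : ℤ) : ZMod S)⁻¹).val : ℕ) : ℂ) / (S : ℂ))) *
        (Complex.exp (2 * Real.pi * Complex.I * (((-(k₂ * Y) : ℤ) : ℂ) / ((b * S * n₂ : ℕ) : ℂ))) *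
          (Complex.exp (2 * Real.pi * Complex.I *
              (((k₂ * Y : ℤ) : ℂ) * ((((((n₂ : ℤ) * S : ℤ) : ZMod b)⁻¹).val : ℕ) : ℂ) / (b : ℂ))) *
            Complex.exp (2 * Real.pi * Complex.I *
              (((k₂ * Y * (((b : ZMod S)⁻¹).val : ℕ) : ℤ) : ℂ) *
                (((((n₂ : ℤ) : ZMod S)⁻¹).val : ℕ) : ℂ) / (S : ℂ)))))
      = Complex.exp (2 * Real.pi * Complex.I *
            (((k₂ * Y : ℤ) : ℂ) * ((((((n₂ : ℤ) * S : ℤ) : ZMod b)⁻¹).val : ℕ) : ℂ) / (b : ℂ))) *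
          Complex.exp (2 * Real.pi * Complex.I * (((-(k₂ * Y) : ℤ) : ℂ) / ((b * S * n₂ : ℕ) : ℂ))) *
          (Complex.exp (2 * Real.pi * Complex.I *
              (((-Y₁ * ((((b * (ℓ₂ * ℓ₂') : ℕ) : ZMod n₁)⁻¹).val : ℕ) * (ℓ₁ * ℓ₁' : ℕ) : ℤ) :
                ℂ) * (((((n₂ : ℤ) : ZMod S)⁻¹).val : ℕ) : ℂ) / (S : ℂ))) *
            Complex.exp (2 * Real.pi * Complex.I *
              (((k₂ * Y * (((b : ZMod S)⁻¹).val : ℕ) : ℤ) : ℂ) *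
                (((((n₂ : ℤ) : ZMod S)⁻¹).val : ℕ) : ℂ) / (S : ℂ)))) := by ring
    _ = _ := by rw [hcomb]


/-- **The frequency of a pair modulo `S`**: with `S = t n₁` (`t = ℓ₁ℓ₁'`), `(bℓ₂ℓ₂', n₁) = 1`,
`(b, S) = 1`, the frequency `a = (−Y₁)(bℓ₂ℓ₂')‾^{(n₁)} t + (k₂Y₂) b̄^{(S)}` of `BC_pair_final2`
satisfies `a · (bℓ₂ℓ₂') ≡ k₂Y₂ℓ₂ℓ₂' − Y₁t (mod S)` (for the trilinear form this is `ϑΔ`, `Δ` as in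
the source; the tree's `kfw_freq_congr` is the case `ℓ₂ = ℓ₂'`, one numerator).
[cite: BettinChandee2018, §4.1.3 (afed)] -/
theorem BC_freq_congr2 (Y₁ k₂ Y₂ : ℤ) {b ℓ₂ ℓ₂' n₁ t S : ℕ} (hS : S = t * n₁) (hn₁ : 0 < n₁)
    (ht : 0 < t) (hσ₁ : (b * (ℓ₂ * ℓ₂')).Coprime n₁) (hσ : b.Coprime S) :
    ((((-Y₁) * ((((b * (ℓ₂ * ℓ₂') : ℕ) : ZMod n₁)⁻¹).val : ℕ) * t +
        (k₂ * Y₂) * (((b : ZMod S)⁻¹).val : ℕ)) * (b * (ℓ₂ * ℓ₂') : ℕ) : ℤ) : ZMod S) =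
      ((k₂ * Y₂ * (ℓ₂ * ℓ₂' : ℕ) - Y₁ * t : ℤ) : ZMod S) := by
  haveI : NeZero n₁ := ⟨hn₁.ne'⟩
  have hS0 : 0 < S := by rw [hS]; exact Nat.mul_pos ht hn₁
  haveI : NeZero S := ⟨hS0.ne'⟩
  -- `σ b = 1` in `ℤ/S`
  have hσb : ((((b : ZMod S)⁻¹).val : ℕ) : ZMod S) * (b : ZMod S) = 1 := by
    rw [ZMod.natCast_zmod_val, ZMod.inv_mul_of_unit _ ((ZMod.isUnit_iff_coprime b S).mpr hσ)]
  -- `σ₁ (bℓ₂ℓ₂') = 1` in `ℤ/n₁`, hence `S = t n₁ ∣ t (σ₁ bℓ₂ℓ₂' - 1)`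
  have hu₁ : IsUnit ((b * (ℓ₂ * ℓ₂') : ℕ) : ZMod n₁) := (ZMod.isUnit_iff_coprime _ _).mpr hσ₁
  have e1 : (((((b * (ℓ₂ * ℓ₂') : ℕ) : ZMod n₁)⁻¹).val : ℕ) : ZMod n₁) *
      ((b * (ℓ₂ * ℓ₂') : ℕ) : ZMod n₁) = 1 := by
    rw [ZMod.natCast_zmod_val, ZMod.inv_mul_of_unit _ hu₁]
  have h1 : (n₁ : ℤ) ∣
      ((((((b * (ℓ₂ * ℓ₂') : ℕ) : ZMod n₁)⁻¹).val : ℕ) : ℤ) * ((b * (ℓ₂ * ℓ₂') : ℕ) : ℤ) - 1) := by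
    rw [← ZMod.intCast_zmod_eq_zero_iff_dvd, Int.cast_sub, Int.cast_mul, Int.cast_natCast,
      Int.cast_natCast, Int.cast_one, e1, sub_self]
  have hdvd : (S : ℤ) ∣ (t : ℤ) *
      ((((((b * (ℓ₂ * ℓ₂') : ℕ) : ZMod n₁)⁻¹).val : ℕ) : ℤ) * ((b * (ℓ₂ * ℓ₂') : ℕ) : ℤ) - 1) := by
    rw [hS, Nat.cast_mul]; exact mul_dvd_mul_left (t : ℤ) h1
  have ht0 : ((((t : ℤ) *
      ((((((b * (ℓ₂ * ℓ₂') : ℕ) : ZMod n₁)⁻¹).val : ℕ) : ℤ) * ((b * (ℓ₂ * ℓ₂') : ℕ) : ℤ) - 1)) :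
        ℤ) : ZMod S) = 0 :=
    (ZMod.intCast_zmod_eq_zero_iff_dvd _ S).mpr hdvd
  push_cast at ht0 hσb ⊢
  linear_combination (-(Y₁ : ZMod S)) * ht0 + ((k₂ : ZMod S) * Y₂ * (ℓ₂ * ℓ₂')) * hσb


end Literature.NumberTheory.LFunctions

end
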